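import Mathlib
import Summits.ValiantsHypothesis.ValiantsHypothesis.Theorems.NewtonUnitEquationsTwoProductsDepthOne
import Summits.ValiantsHypothesis.ValiantsHypothesis.Theorems.NewtonUnitEquationsTwoProductsPowerSumCriterion
/-! # Stub `stub_allDeadCancellationFree` — crux `TwoProducts` (stmt-ValiantsHypothesis-5906), line `corner-log-linearization`
   The first ALL-DEAD rung of the engine, uniform in the number `n` of factors.

   Setting: a one-sided instance `D = ∏ u_i − q` (that is `v = (q, 1, …, 1)`) with unit constant
   terms and `q` `t`-sparse, whose `u`-product is CANCELLATION-FREE — every word `a` with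
   `a_i ∈ supp u_i` has `coeff_{Σ a_i} ∏ u_i ≠ 0` (e.g. all coefficients positive reals) — and which
   is ALL-DEAD: no monomial of a factor `u_i` and no monomial of `q` survives in `D`.  Claim: `D` has
   at most `t²` south-west vertices (strict minimisers over `supp D` of a linear form with both
   weights positive).

   Proof: let `e` be such a vertex for the weight `w`.  The letters of `q` being dead, `e ∉ supp q`,
   so `coeff_e ∏ u = coeff_e D ≠ 0` and `e = Σ a_i` with `a_i ∈ supp u_i`.  Not all `a_i` vanish
   (`coeff_0 D = 1 − 1 = 0`), and if exactly one `a_{i₀}` is nonzero then `e = a_{i₀}` is a (dead)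
   letter of `u_{i₀}` — impossible.  So two parts `a_{i₀}, a_{i₁}` are nonzero; split
   `e = z₁ + z₂` with `z₁ = a_{i₀}` and `z₂ = Σ_{i ≠ i₀} a_i`.  Both are sums of words (pad with the
   exponent `0 ∈ supp u_i`), so `coeff_{z_k} ∏ u ≠ 0` by cancellation-freeness; both are strictly
   `w`-lighter than `e`, hence not in `supp D` (minimality of `e`), i.e.
   `coeff_{z_k} q = coeff_{z_k} ∏ u ≠ 0`: both are letters of `q`.  Thus the vertices lie in
   `supp q + supp q`, a set of size `≤ t²`. [folklore] -/
set_option linter.dupNamespace false -- single-conjunct summit: `ValiantsHypothesis.ValiantsHypothesis`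
namespace Summit.ValiantsHypothesis.ValiantsHypothesis.Theorems.TwoProducts.CancellationFree
open scoped BigOperators Pointwise
open MvPolynomial
open Summit.ValiantsHypothesis.ValiantsHypothesis.Theorems.TwoProducts.DepthOne
open Summit.ValiantsHypothesis.ValiantsHypothesis.Theorems.TwoProducts.PowerSum (coeff_zero_prod_eq_one)

/-- KEY STEP.  For a one-sided, cancellation-free, all-dead instance `D = ∏ u_i − q` with unit
constant terms, every south-west vertex of `supp D` is a sum of two letters of `q`. [folklore] -/
theorem vertex_mem_add {n : ℕ} (u : Fin n → MvPolynomial (Fin 2) ℂ) (q : MvPolynomial (Fin 2) ℂ)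
    (hu0 : ∀ i, coeff 0 (u i) = 1) (hq0 : coeff 0 q = 1)
    (hcf : ∀ a : Fin n → (Fin 2 →₀ ℕ), (∀ i, a i ∈ (u i).support) → coeff (∑ i, a i) (∏ i, u i) ≠ 0)
    (hdeadU : ∀ i, ∀ e ∈ (u i).support, e ∉ (∏ i, u i - q).support)
    (hdeadQ : ∀ e ∈ q.support, e ∉ (∏ i, u i - q).support)
    (w : Fin 2 → ℤ) (hw0 : 0 < w 0) (hw1 : 0 < w 1) (e : Fin 2 →₀ ℕ)
    (he : e ∈ (∏ i, u i - q).support)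
    (hmin : ∀ e' ∈ (∏ i, u i - q).support, e' ≠ e →
      w 0 * (e 0 : ℤ) + w 1 * (e 1 : ℤ) < w 0 * (e' 0 : ℤ) + w 1 * (e' 1 : ℤ)) :
    ∃ z₁ ∈ q.support, ∃ z₂ ∈ q.support, z₁ + z₂ = e := by
  classical
  -- a strictly lighter exponent with nonzero `∏ u`-coefficient is a letter of `q`
  have letter : ∀ z : Fin 2 →₀ ℕ, coeff z (∏ i, u i) ≠ 0 →
      w 0 * (z 0 : ℤ) + w 1 * (z 1 : ℤ) < w 0 * (e 0 : ℤ) + w 1 * (e 1 : ℤ) → z ∈ q.support := by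
    intro z hz hlt
    by_contra hzq
    have hzD : z ∈ (∏ i, u i - q).support := by
      rw [mem_support_iff, coeff_sub, notMem_support_iff.mp hzq, sub_zero]
      exact hz
    have hne : z ≠ e := by
      rintro rfl
      exact lt_irrefl _ hlt
    exact lt_asymm hlt (hmin z hzD hne)
  -- `e` is not a letter of `q`, hence it is an exponent of `∏ u`
  have heq : coeff e q = 0 := by
    by_contra h
    exact hdeadQ e (mem_support_iff.mpr h) he
  have heU : e ∈ (∏ i, u i).support := by
    have h := mem_support_iff.mp he
    rw [coeff_sub, heq, sub_zero] at h
    exact mem_support_iff.mpr h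
  obtain ⟨a, ha, hea⟩ := exists_rep_of_mem_support_prod n u e heU
  -- zero is a letter of every factor
  have h0 : ∀ i, (0 : Fin 2 →₀ ℕ) ∈ (u i).support := fun i => by
    rw [mem_support_iff, hu0 i]
    exact one_ne_zero
  -- at least one part is nonzero
  obtain ⟨i₀, hi₀⟩ : ∃ i, a i ≠ 0 := by
    by_contra hall
    push Not at hall
    have he0 : e = 0 := by
      rw [hea]
      exact Finset.sum_eq_zero fun i _ => hall i
    apply mem_support_iff.mp he
    rw [he0, coeff_sub, hq0, coeff_zero_prod_eq_one u hu0, sub_self]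
  -- at least two parts are nonzero
  obtain ⟨i₁, hi₁₀, hi₁⟩ : ∃ j, j ≠ i₀ ∧ a j ≠ 0 := by
    by_contra hall
    push Not at hall
    have he1 : e = a i₀ := by
      rw [hea, Finset.sum_eq_single i₀ (fun j _ hj => hall j hj)
        (fun h => absurd (Finset.mem_univ i₀) h)]
    refine hdeadU i₀ e ?_ he
    rw [he1]
    exact ha i₀
  -- the splitting `e = a i₀ + Σ_{i ≠ i₀} a i`
  have hsplit : a i₀ + ∑ i ∈ Finset.univ.erase i₀, a i = e := by
    rw [hea]
    exact Finset.add_sum_erase Finset.univ a (Finset.mem_univ i₀)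
  -- both parts have nonzero coefficient in `∏ u`
  have hc₁ : coeff (a i₀) (∏ i, u i) ≠ 0 := by
    have h := hcf (Pi.single i₀ (a i₀)) fun i => by
      by_cases hi : i = i₀
      · rw [hi, Pi.single_eq_same]
        exact ha i₀
      · rw [Pi.single_eq_of_ne hi]
        exact h0 i
    simpa [Finset.sum_pi_single'] using h
  have hc₂ : coeff (∑ i ∈ Finset.univ.erase i₀, a i) (∏ i, u i) ≠ 0 := by
    have hsum : ∑ i, Function.update a i₀ 0 i = ∑ i ∈ Finset.univ.erase i₀, a i := by
      rw [← Finset.add_sum_erase _ _ (Finset.mem_univ i₀), Function.update_self, zero_add]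
      exact Finset.sum_congr rfl fun i hi => Function.update_of_ne (Finset.ne_of_mem_erase hi) _ _
    rw [← hsum]
    exact hcf _ fun i => by
      by_cases hi : i = i₀
      · rw [hi, Function.update_self]
        exact h0 i₀
      · rw [Function.update_of_ne hi]
        exact ha i
  -- both parts are strictly lighter than `e`
  have hlt₁ : w 0 * (a i₀ 0 : ℤ) + w 1 * (a i₀ 1 : ℤ) < w 0 * (e 0 : ℤ) + w 1 * (e 1 : ℤ) := by
    have h := wt_partial_lt w hw0 hw1 a {i₀} i₁ (by simpa using hi₁₀) hi₁
    rw [Finset.sum_singleton, ← hea] at h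
    exact h
  have hlt₂ : w 0 * ((∑ i ∈ Finset.univ.erase i₀, a i) 0 : ℤ) +
      w 1 * ((∑ i ∈ Finset.univ.erase i₀, a i) 1 : ℤ) < w 0 * (e 0 : ℤ) + w 1 * (e 1 : ℤ) := by
    have h := wt_partial_lt w hw0 hw1 a (Finset.univ.erase i₀) i₀ (Finset.notMem_erase i₀ _) hi₀
    rw [← hea] at h
    exact h
  exact ⟨a i₀, letter _ hc₁ hlt₁, _, letter _ hc₂ hlt₂, hsplit⟩

/-- STUB `stub_allDeadCancellationFree` (first all-dead rung of the engine, uniform in `n`):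
a one-sided instance `D = ∏ u_i − q` with unit constant terms, `q` `t`-sparse, whose `u`-product
is cancellation-free and all of whose letters (of the `u_i` and of `q`) are dead in `D`, has at most
`t²` south-west vertices — each of them is a sum of two letters of `q`. [folklore] -/
theorem stub_allDeadCancellationFree : ∀ (n t : ℕ) (u : Fin n → MvPolynomial (Fin 2) ℂ) (q : MvPolynomial (Fin 2) ℂ), (∀ i, MvPolynomial.coeff 0 (u i) = 1) → MvPolynomial.coeff 0 q = 1 → q.support.card ≤ t → (∀ a : Fin n → (Fin 2 →₀ ℕ), (∀ i, a i ∈ (u i).support) → MvPolynomial.coeff (∑ i, a i) (∏ i, u i) ≠ 0) → (∀ i, ∀ e ∈ (u i).support, e ∉ (∏ i, u i - q).support) → (∀ e ∈ q.support, e ∉ (∏ i, u i - q).support) → {e : Fin 2 →₀ ℕ | ∃ w : Fin 2 → ℤ, 0 < w 0 ∧ 0 < w 1 ∧ e ∈ (∏ i, u i - q).support ∧ ∀ e' ∈ (∏ i, u i - q).support, e' ≠ e → w 0 * (e 0 : ℤ) + w 1 * (e 1 : ℤ) < w 0 * (e' 0 : ℤ) + w 1 * (e' 1 : ℤ)}.ncard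 ≤ t * t := by
  intro n t u q hu0 hq0 hqt hcf hdeadU hdeadQ
  classical
  set G : Finset (Fin 2 →₀ ℕ) := (q.support ×ˢ q.support).image fun p => p.1 + p.2 with hG
  set SW := {e : Fin 2 →₀ ℕ | ∃ w : Fin 2 → ℤ, 0 < w 0 ∧ 0 < w 1 ∧ e ∈ (∏ i, u i - q).support ∧
      ∀ e' ∈ (∏ i, u i - q).support, e' ≠ e →
        w 0 * (e 0 : ℤ) + w 1 * (e 1 : ℤ) < w 0 * (e' 0 : ℤ) + w 1 * (e' 1 : ℤ)} with hSW
  have hsub : SW ⊆ ↑G := by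
    rintro e ⟨w, hw0, hw1, he, hmin⟩
    obtain ⟨z₁, hz₁, z₂, hz₂, rfl⟩ :=
      vertex_mem_add u q hu0 hq0 hcf hdeadU hdeadQ w hw0 hw1 e he hmin
    rw [Finset.mem_coe, hG, Finset.mem_image]
    exact ⟨(z₁, z₂), Finset.mem_product.mpr ⟨hz₁, hz₂⟩, rfl⟩
  calc SW.ncard ≤ (↑G : Set (Fin 2 →₀ ℕ)).ncard := Set.ncard_le_ncard hsub G.finite_toSet
    _ = G.card := Set.ncard_coe_finset G
    _ ≤ (q.support ×ˢ q.support).card := Finset.card_image_le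
    _ = q.support.card * q.support.card := Finset.card_product _ _
    _ ≤ t * t := Nat.mul_le_mul hqt hqt

end Summit.ValiantsHypothesis.ValiantsHypothesis.Theorems.TwoProducts.CancellationFree
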